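import Summits.HodgeConjecture.HodgeConjecture.Theorems.VHCAbelianSchemesRoadSecantQuotientAnchorLevelTransferDefs
import HarnessLib

/-!
# Road b02 (`VHCAbelianSchemesRoad`, D-0059) — THE G3 NODE, NAMED: «AT ONE PINNED ANCHOR, ONE CARRIED RATIONAL WEIL DIRECTION CARRIES THEM ALL»
# (`SecantQuotientSameAnchorTransfer63 𝒪`), lane W1's half of the ∀-node behind stub 2a‴ of crux `SemiregularSheafRepresentativesTwPrimeAtDiag`
# (item stmt-HodgeConjecture-20707, skeleton v3.3), so that node = G1 ∧ G3 BY NAME on both sides (definitions and fact-free glue only)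

research route conditional on HC_CM; not a corollary; Q11.4-sentence-2 already refuted in dim ≥ 3.

DEFINITIONS AND FACT-FREE GLUE ONLY (`HC_CM` nowhere; nothing asserted; the claim-tagged preprint leaf L1″
`HodgeTheory.Markman2025_secantQuotient_twistedCarrier_onJacobian_pinned` enters the glue theorems as a HYPOTHESIS by name; the print leaf
`TwistedPerfectDoorPrime` of item 20706 is not restated). ring2-b03x gen 3 on director-hodge g10 R10.4 (4) + HOME INBOX 2026-08-27T19:29:23Z «NAME G3 on
your side as the first decl of your G3 file, after R2» (ring2-b03 g86, 19:28:37Z: «I displayed it inline, did not name it»). The ∀-node of this lineage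
(`SecantQuotientWeilDirectionTransfer63 𝒪`, p556635: same-level transfer of carried-ness to every pinned anchor AND every rational pinned-served Weil
direction) is the conjunction of two cleanly separated statements — lane R's (G1) `SecantQuotientAnchorLevelTransfer63 𝒪` (p561877: carried-ness of
SOME rational pinned-served direction travels across the anchors of one level) and lane W1's (G3), named HERE with p561877's inline hypothesis VERBATIM as
its body, so that b03's glue theorems apply by definitional unfolding:

* `SecantQuotientSameAnchorTransfer63 𝒪` (`@[conjecture]`, door-generic): for every level `d`, every level-`d` secant–quotient anchor WITH ITS CLASS
  `(X, θ)` (`Markman2025.IsSecantQuotientAnchorWith d X θ`) and all rational pinned-served `w, w' ∈ 𝔖^pin X θ`: **if `w'` is `𝒪`-carried at `(X, θ)`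
  then so is `w`** (`AbelianAll.carriedClasses 𝒪 6 3 X θ`: an `𝒪`-datum `(I ∋ 3, κ)` on `X` with `κ₃ = a·w + c₃·θ³`, `a ≠ 0`, the other `κ_k` on the
  `θ`-rays). DOMAIN (companion theorem file `…SecantQuotientAnchorPinnedWeilPlane`, fact-free): at the identity chart of a datum the rational pinned-served
  classes are exactly the NON-ZERO rational classes whose pull-back lies in the Weil plane `E₊ ⊕ E₋` of `(J × Ĵ, φ_d)` (the off-ray clause is `γ ≠ 0`,
  because under R2's compatibility `φ_d^*Ξ = d·Ξ` the ray `ℂ·Ξ³` is the `d³`-eigenline and the plane the `(-d)³`-eigenspace of `φ_d^*`) — a `P¹(ℚ)`-worth of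
  directions per anchor, on which `φ_d^*` ∕ `ψ_Y^*` act TRIVIALLY (scalar `-d³`): (G3) is not class-level transport along `K = ℚ(√-d)`.
* `SecantQuotientSameAnchorTransfer63PinnedPrime C` (`@[conjecture]`): (G3) for the primed twisted door `tw C AdmTw′` — the reading stub 2a‴ consumes.
* §2 GLUE BY NAME (fact-free): node ⟹ G3 (`secantQuotientSameAnchorTransfer63_of_weilDirectionTransfer63` = b03x g2's `.sameAnchor`); **G1 ∧ G3 ⟹ node**
  (`weilDirectionTransfer63_of_levelTransfer63_of_sameAnchorTransfer63` = b03 g86's `weilDirectionTransfer63_of_levelTransfer_of_sameAnchor`); node ⟺ G1 ∧ G3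
  modulo the displayed non-emptiness of `𝔖^pin_ℚ` at every level-`d` anchor with class; 2a‴ ⟹ G3′; and THE JUNCTION
  **`secantQuotientAnchorCarrier63PinnedPrime_of_pinned_of_levelTransfer63_of_sameAnchorTransfer63 : L1″(C, AdmTw′) → G1′ C → G3′ C → SecantQuotientAnchorCarrier63PinnedPrime C`**
  (+ the skeleton-shaped `∀ C` form).
* §3 WHAT G3 BUYS ALONE (no G1): modulo L1″(C, Adm) ∧ G3(tw C Adm), at print's OWN anchor of every even level `d ≥ 4` EVERY rational pinned-served
  direction is carried (`exists_printAnchor_forall_carried_of_pinned_of_sameAnchorTransfer63`) — stub 2a‴ restricted to print's anchors; (G1) is then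
  exactly the passage to the other anchors of the level.

WHY G3 IS NOT IN PRINT AND MIGHT FAIL (this lineage's evidence n°9∕n°10 §3, refute-markman g2): print carries ONE direction `γ₀` per anchor (Thm. 1.4.1
item 4: the Weil component of `κ₃(𝓔̄ ⊗ det^{-1/8d})`) and reaches the others at CLASS level only (`u ↦ u⁶` on `W_ℚ ≅ K`); at datum level `φ_d^*` ∕ `ψ_Y^*`
fix every direction (companion file), pull-back along the descended `K`-endomorphisms `ḡ_u` reaches `K^{×6}ℚ^× ⊊ K^×` and is not known to preserve
`AdmTw′`-admissibility, admissible data do not add (André column AE.1), and deformation inside the level-`d` family returns to the same fibre with finitely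
many directions (finite determinant monodromy). So G3 asks for GENUINELY NEW semiregular objects at print's anchor, one per rational direction class
modulo `ℚ^×·{u⁶}`. OPEN; a HYPOTHESIS wherever used.

Nothing here says G1, G3, the node, L1″, 2a‴, any cell, rung, crux, K-SR♭∃, VHC, `HC_AV`, `HC_CM` or HC holds.
References: [cite: Markman2025SecantWeil, §1.3 (p. 5), §1.5 (p. 7), Thm. 1.4.1 (item 4), Thm. 1.5.1, §3.2 Cor. 3.2.3 and Lemma 9.3.11]
[cite: Bloch1972Semiregularity, Remark (7.5)] [cite: BuchweitzFlenner2003, §5 Thm. 5.1] [cite: Pridham2024Semiregularity, Cor. 2.25 and Rem. 2.26]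
[cite: vanGeemen1994HodgeAV, 4.9, Lemma 5.2 and Thm. 4.11] [cite: MoonenZarhin1998WeilClasses, §1].
-/

noncomputable section

open CategoryTheory CategoryTheory.Limits AlgebraicGeometry Topology

namespace Summit.HodgeConjecture.HodgeConjecture.Ring2.SemiregularRepresentatives

set_option linter.dupNamespace false -- the cell's namespace repeats the summit name, as in every `Ring2*` file

open Literature.AlgebraicGeometry Literature.AlgebraicGeometry.Motives Literature.AlgebraicGeometry.Motives.AbelianVariety
open Literature.AlgebraicGeometry.HodgeTheory Literature.AlgebraicGeometry.Markman2025
open Literature.AlgebraicTopology.SingularHomology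
open Summit.Ventures.HSemireg (ObjClass)
open Summit.HodgeConjecture.HodgeConjecture.Ring2.AbelianAll (carriedClasses)

/-! ## §1 The G3 node, named -/

/-- **(G3) `SecantQuotientSameAnchorTransfer63 𝒪` — AT ONE PINNED ANCHOR, ONE CARRIED RATIONAL PINNED-SERVED DIRECTION CARRIES EVERY RATIONAL
PINNED-SERVED DIRECTION** (lane W1's half of the ∀-node `SecantQuotientWeilDirectionTransfer63 𝒪`; body = ring2-b03's inline hypothesis `hG3` of
`weilDirectionTransfer63_of_levelTransfer_of_sameAnchor`, verbatim). For every level `d`, every level-`d` secant–quotient anchor with its class `(X, θ)`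
(`IsSecantQuotientAnchorWith d X θ`) and all rational `w, w' ∈ secantQuotientServedClassesPinned X θ`: `w' ∈ carriedClasses 𝒪 6 3 X θ → w ∈ carriedClasses 𝒪 6 3 X θ`.
Domain: the non-zero rational points of the descended Weil plane at `(X, θ)`, a `P¹(ℚ)`-worth of directions, all FIXED by `φ_d^*` (companion file
`…SecantQuotientAnchorPinnedWeilPlane`). In print only at class level (Thm. 1.4.1 item 4, `u ↦ u⁶` on `W_ℚ ≅ K`); at datum level it asks for new
semiregular objects. OPEN; a HYPOTHESIS wherever used. [cite: Markman2025SecantWeil, Thm. 1.4.1 (item 4), §1.5 (p. 7) and Thm. 1.5.1]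
[cite: Bloch1972Semiregularity, Remark (7.5)] [cite: vanGeemen1994HodgeAV, 4.9 and Thm. 4.11] [status: open] -/
@[conjecture] def SecantQuotientSameAnchorTransfer63 (𝒪 : ObjClass) : Prop :=
  ∀ (d : ℕ) ⦃X : SchemeOver ℂ⦄ ⦃θ : complexBetti X 2⦄ ⦃w w' : complexBetti X (2 * 3)⦄,
    IsSecantQuotientAnchorWith d X θ → w ∈ secantQuotientServedClassesPinned X θ → IsRationalClass w →
    w' ∈ secantQuotientServedClassesPinned X θ → IsRationalClass w' → w' ∈ carriedClasses 𝒪 6 3 X θ →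
    w ∈ carriedClasses 𝒪 6 3 X θ

/-- **(G3′) for the PRIMED twisted door `tw C AdmTw′`**, `AdmTw′ := gluableSigmaAdmissible ∨ bfSingleAdmissible′` — the reading that feeds stub 2a‴ of
skeleton v3.3 (item stmt-HodgeConjecture-20707) through §2. OPEN; a HYPOTHESIS wherever used. [cite: Markman2025SecantWeil, Thm. 1.4.1 (item 4), §1.5 and §9.3 Lemma 9.3.11]
[cite: BuchweitzFlenner2003, §5 Thm. 5.1] [cite: Pridham2024Semiregularity, Cor. 2.25 and Rem. 2.26] [status: open] -/
@[conjecture] def SecantQuotientSameAnchorTransfer63PinnedPrime (C : ChernCharacterBetti) : Prop :=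
  SecantQuotientSameAnchorTransfer63 (Literature.AlgebraicGeometry.HodgeTheory.twistedReflexiveClass C
    (fun n X₀ I E => Summit.Ventures.HSemireg.gluableSigmaAdmissible n X₀ I E ∨
      Literature.AlgebraicGeometry.HodgeTheory.bfSingleAdmissible' n X₀ I E))

variable {𝒪 : ObjClass} {C : ChernCharacterBetti} {Adm : PerfectAdmissibility}

/-- The primed G3 node, unfolded (definitional). [cite: Markman2025SecantWeil, Thm. 1.4.1] -/
theorem secantQuotientSameAnchorTransfer63PinnedPrime_iff :
    SecantQuotientSameAnchorTransfer63PinnedPrime C ↔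
      SecantQuotientSameAnchorTransfer63 (Literature.AlgebraicGeometry.HodgeTheory.twistedReflexiveClass C
        (fun n X₀ I E => Summit.Ventures.HSemireg.gluableSigmaAdmissible n X₀ I E ∨
          Literature.AlgebraicGeometry.HodgeTheory.bfSingleAdmissible' n X₀ I E)) :=
  Iff.rfl

/-- (G3) applied (argument form). [cite: Markman2025SecantWeil, Thm. 1.4.1 (item 4)] -/
theorem SecantQuotientSameAnchorTransfer63.apply (hG3 : SecantQuotientSameAnchorTransfer63 𝒪) {d : ℕ} {X : SchemeOver ℂ} {θ : complexBetti X 2}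
    (hX : IsSecantQuotientAnchorWith d X θ) {w w' : complexBetti X (2 * 3)} (hw : w ∈ secantQuotientServedClassesPinned X θ)
    (hwQ : IsRationalClass w) (hw' : w' ∈ secantQuotientServedClassesPinned X θ) (hw'Q : IsRationalClass w')
    (hc : w' ∈ carriedClasses 𝒪 6 3 X θ) : w ∈ carriedClasses 𝒪 6 3 X θ :=
  hG3 d hX hw hwQ hw' hw'Q hc

/-! ## §2 Fact-free glue by name: node = G1 ∧ G3; the junction for stub 2a‴ -/

/-- **node ⟹ G3** (ring2-b03x g2's `SecantQuotientWeilDirectionTransfer63.sameAnchor`, now by name). [cite: Markman2025SecantWeil, Thm. 1.4.1 (item 4)] -/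
theorem secantQuotientSameAnchorTransfer63_of_weilDirectionTransfer63 (hN : SecantQuotientWeilDirectionTransfer63 𝒪) :
    SecantQuotientSameAnchorTransfer63 𝒪 :=
  sameAnchorTransfer63_of_weilDirectionTransfer63 hN

/-- **G1 ∧ G3 ⟹ node** (ring2-b03 g86's `weilDirectionTransfer63_of_levelTransfer_of_sameAnchor`, both halves by name): transfer to `(X, θ, w)` from
`(X', θ', w')` = carry SOME rational pinned-served direction from `X'` to `X` (G1), then carry `w` from it at `X` (G3).
[cite: Markman2025SecantWeil, Thm. 1.4.1 (item 4), §1.5 and Thm. 1.5.1] -/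
theorem weilDirectionTransfer63_of_levelTransfer63_of_sameAnchorTransfer63 (hG1 : SecantQuotientAnchorLevelTransfer63 𝒪)
    (hG3 : SecantQuotientSameAnchorTransfer63 𝒪) : SecantQuotientWeilDirectionTransfer63 𝒪 :=
  weilDirectionTransfer63_of_levelTransfer_of_sameAnchor hG1 hG3

/-- **node ⟺ G1 ∧ G3, modulo the displayed non-emptiness of the rational pinned-served set at every level-`d` anchor with class** (needed only for
node ⟹ G1: `levelTransfer63_of_weilDirectionTransfer63`). [cite: Markman2025SecantWeil, Thm. 1.4.1 (item 4) and §1.5] -/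
theorem weilDirectionTransfer63_iff_levelTransfer63_and_sameAnchorTransfer63
    (hne : ∀ (d : ℕ) ⦃X : SchemeOver ℂ⦄ ⦃θ : complexBetti X 2⦄, IsSecantQuotientAnchorWith d X θ →
      ∃ w : complexBetti X (2 * 3), w ∈ secantQuotientServedClassesPinned X θ ∧ IsRationalClass w) :
    SecantQuotientWeilDirectionTransfer63 𝒪 ↔ SecantQuotientAnchorLevelTransfer63 𝒪 ∧ SecantQuotientSameAnchorTransfer63 𝒪 :=
  ⟨fun hN ↦ ⟨levelTransfer63_of_weilDirectionTransfer63 hN hne, secantQuotientSameAnchorTransfer63_of_weilDirectionTransfer63 hN⟩,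
    fun h ↦ weilDirectionTransfer63_of_levelTransfer63_of_sameAnchorTransfer63 h.1 h.2⟩

/-- **primed node ⟹ G3′.** [cite: Markman2025SecantWeil, Thm. 1.4.1 (item 4)] -/
theorem secantQuotientSameAnchorTransfer63PinnedPrime_of_weilDirectionTransfer63PinnedPrime
    (hN : SecantQuotientWeilDirectionTransfer63PinnedPrime C) : SecantQuotientSameAnchorTransfer63PinnedPrime C :=
  secantQuotientSameAnchorTransfer63_of_weilDirectionTransfer63 hN

/-- **G1′ ∧ G3′ ⟹ primed node.** [cite: Markman2025SecantWeil, Thm. 1.4.1 (item 4), §1.5 and Thm. 1.5.1] -/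
theorem weilDirectionTransfer63PinnedPrime_of_levelTransfer63PinnedPrime_of_sameAnchorTransfer63PinnedPrime
    (hG1 : SecantQuotientAnchorLevelTransfer63PinnedPrime C) (hG3 : SecantQuotientSameAnchorTransfer63PinnedPrime C) :
    SecantQuotientWeilDirectionTransfer63PinnedPrime C :=
  weilDirectionTransfer63_of_levelTransfer63_of_sameAnchorTransfer63 hG1 hG3

/-- **Stub 2a‴ ⟹ G3′** (the stub implies the node outright, and the node its same-anchor half): G3′ is NECESSARY for the stub.
[cite: Markman2025SecantWeil, Thm. 1.4.1 (item 4)] [cite: Bloch1972Semiregularity, Remark (7.5)] -/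
theorem secantQuotientSameAnchorTransfer63PinnedPrime_of_secantQuotientAnchorCarrier63PinnedPrime (h : SecantQuotientAnchorCarrier63PinnedPrime C) :
    SecantQuotientSameAnchorTransfer63PinnedPrime C :=
  secantQuotientSameAnchorTransfer63PinnedPrime_of_weilDirectionTransfer63PinnedPrime
    (weilDirectionTransfer63PinnedPrime_of_secantQuotientAnchorCarrier63PinnedPrime h)

/-- **THE JUNCTION FOR STUB 2a‴, BY NAME ON BOTH LANES: `L1″(C, AdmTw′) ∧ G1′ ∧ G3′ ⟹ SecantQuotientAnchorCarrier63PinnedPrime C`** (ring2-b03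
g86's `secantQuotientAnchorCarrier63PinnedPrime_of_pinned_of_levelTransfer_of_sameAnchor` with G3′ named). Nothing here says any input holds.
[cite: Markman2025SecantWeil, Thm. 1.4.1 (item 4), §1.5, Thm. 1.5.1 and Lemma 9.3.11] [cite: Bloch1972Semiregularity, Remark (7.5)] [cite: BuchweitzFlenner2003, §5 Thm. 5.1] -/
theorem secantQuotientAnchorCarrier63PinnedPrime_of_pinned_of_levelTransfer63_of_sameAnchorTransfer63
    (hM : Markman2025_secantQuotient_twistedCarrier_onJacobian_pinned C
      (fun n X₀ I E => Summit.Ventures.HSemireg.gluableSigmaAdmissible n X₀ I E ∨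
        Literature.AlgebraicGeometry.HodgeTheory.bfSingleAdmissible' n X₀ I E))
    (hG1 : SecantQuotientAnchorLevelTransfer63PinnedPrime C) (hG3 : SecantQuotientSameAnchorTransfer63PinnedPrime C) :
    SecantQuotientAnchorCarrier63PinnedPrime C :=
  secantQuotientAnchorCarrier63PinnedPrime_of_pinned_of_levelTransfer_of_sameAnchor hM hG1 hG3

/-- **The skeleton-shaped form**: from `∀ C, L1″(C, AdmTw′)`, `∀ C, G1′ C` and `∀ C, G3′ C`, the exact type `∀ C, SecantQuotientAnchorCarrier63PinnedPrime C`
of `stub_anchorCarrier_63_secantQuotientPinnedPrime` (skeleton v3.3) — a CONDITIONAL packaging, not a stub close. [cite: Markman2025SecantWeil, Thm. 1.4.1 (item 4) and §1.5]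
[cite: Bloch1972Semiregularity, Remark (7.5)] -/
theorem forall_secantQuotientAnchorCarrier63PinnedPrime_of_pinned_of_levelTransfer63_of_sameAnchorTransfer63
    (hM : ∀ C : ChernCharacterBetti, Markman2025_secantQuotient_twistedCarrier_onJacobian_pinned C
      (fun n X₀ I E => Summit.Ventures.HSemireg.gluableSigmaAdmissible n X₀ I E ∨
        Literature.AlgebraicGeometry.HodgeTheory.bfSingleAdmissible' n X₀ I E))
    (hG1 : ∀ C : ChernCharacterBetti, SecantQuotientAnchorLevelTransfer63PinnedPrime C)
    (hG3 : ∀ C : ChernCharacterBetti, SecantQuotientSameAnchorTransfer63PinnedPrime C) :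
    ∀ C : ChernCharacterBetti, SecantQuotientAnchorCarrier63PinnedPrime C :=
  fun C ↦ secantQuotientAnchorCarrier63PinnedPrime_of_pinned_of_levelTransfer63_of_sameAnchorTransfer63 (hM C) (hG1 C) (hG3 C)

/-- **Modulo L1″(C, AdmTw′) and the displayed non-emptiness: 2a‴ ⟺ G1′ ∧ G3′** — provers stare at the two named halves.
[cite: Markman2025SecantWeil, Thm. 1.4.1 (item 4), §1.5 and Thm. 1.5.1] [cite: Bloch1972Semiregularity, Remark (7.5)] -/
theorem secantQuotientAnchorCarrier63PinnedPrime_iff_levelTransfer63_and_sameAnchorTransfer63_of_pinned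
    (hM : Markman2025_secantQuotient_twistedCarrier_onJacobian_pinned C
      (fun n X₀ I E => Summit.Ventures.HSemireg.gluableSigmaAdmissible n X₀ I E ∨
        Literature.AlgebraicGeometry.HodgeTheory.bfSingleAdmissible' n X₀ I E))
    (hne : ∀ (d : ℕ) ⦃X : SchemeOver ℂ⦄ ⦃θ : complexBetti X 2⦄, IsSecantQuotientAnchorWith d X θ →
      ∃ w : complexBetti X (2 * 3), w ∈ secantQuotientServedClassesPinned X θ ∧ IsRationalClass w) :
    SecantQuotientAnchorCarrier63PinnedPrime C ↔
      SecantQuotientAnchorLevelTransfer63PinnedPrime C ∧ SecantQuotientSameAnchorTransfer63PinnedPrime C := by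
  rw [secantQuotientAnchorCarrier63PinnedPrime_iff_weilDirectionTransfer63PinnedPrime_of_pinned hM]
  exact weilDirectionTransfer63_iff_levelTransfer63_and_sameAnchorTransfer63 hne

/-! ## §3 What G3 buys alone: at print's own anchor of each level, every rational pinned-served direction is carried -/

/-- **Modulo L1″(C, Adm) ∧ G3(tw C Adm): at print's OWN anchor of every even level `d ≥ 4`, EVERY rational pinned-served direction is carried** — the
anchored-carrier stub restricted to print's anchors. Print seeds the anchor with ONE carried rational pinned-served direction
(`exists_carried_secantQuotientPinned_of_pinned`: the Weil component `γ₀` of `κ₃(𝓔̄ ⊗ det^{-1/8d})`); G3 spreads it over the anchor's `P¹(ℚ)` of directions.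
(G1) is then exactly the passage to the OTHER anchors of the level. [cite: Markman2025SecantWeil, Thm. 1.4.1 (item 4), §1.5 (p. 7) and Lemma 9.3.11]
[cite: Bloch1972Semiregularity, Remark (7.5)] -/
theorem exists_printAnchor_forall_carried_of_pinned_of_sameAnchorTransfer63
    (hM : Markman2025_secantQuotient_twistedCarrier_onJacobian_pinned C Adm)
    (hG3 : SecantQuotientSameAnchorTransfer63 (twistedReflexiveClass C Adm)) {d : ℕ} (hd : Even d) (h4 : 4 ≤ d) :
    ∃ (X : SchemeOver ℂ) (θ : complexBetti X 2),
      IsSecantQuotientAnchorWith d X θ ∧ secantQuotientAnchorsPinned X θ ∧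
      ∀ w ∈ secantQuotientServedClassesPinned X θ, IsRationalClass w → w ∈ carriedClasses (twistedReflexiveClass C Adm) 6 3 X θ := by
  obtain ⟨X, θ, γ, hX, hγ, hγQ, -, hc⟩ := exists_carried_secantQuotientPinned_of_pinned hM hd h4
  exact ⟨X, θ, hX, ⟨γ, hγ⟩, fun w hw hwQ ↦ hG3 d hX hw hwQ hγ hγQ hc⟩

/-- **The primed reading: modulo L1″(C, AdmTw′) ∧ G3′ C, print's anchor of every even level `d ≥ 4` carries every rational pinned-served direction by an
`AdmTw′`-admissible twisted datum.** [cite: Markman2025SecantWeil, Thm. 1.4.1 (item 4), §1.5 and Lemma 9.3.11] [cite: BuchweitzFlenner2003, §5 Thm. 5.1] -/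
theorem exists_printAnchor_forall_carried_of_pinnedPrime_of_sameAnchorTransfer63PinnedPrime
    (hM : Markman2025_secantQuotient_twistedCarrier_onJacobian_pinned C
      (fun n X₀ I E => Summit.Ventures.HSemireg.gluableSigmaAdmissible n X₀ I E ∨
        Literature.AlgebraicGeometry.HodgeTheory.bfSingleAdmissible' n X₀ I E))
    (hG3 : SecantQuotientSameAnchorTransfer63PinnedPrime C) {d : ℕ} (hd : Even d) (h4 : 4 ≤ d) :
    ∃ (X : SchemeOver ℂ) (θ : complexBetti X 2),
      IsSecantQuotientAnchorWith d X θ ∧ secantQuotientAnchorsPinned X θ ∧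
      ∀ w ∈ secantQuotientServedClassesPinned X θ, IsRationalClass w →
        w ∈ carriedClasses (twistedReflexiveClass C
          (fun n X₀ I E => Summit.Ventures.HSemireg.gluableSigmaAdmissible n X₀ I E ∨
            Literature.AlgebraicGeometry.HodgeTheory.bfSingleAdmissible' n X₀ I E)) 6 3 X θ :=
  exists_printAnchor_forall_carried_of_pinned_of_sameAnchorTransfer63 hM hG3 hd h4

end Summit.HodgeConjecture.HodgeConjecture.Ring2.SemiregularRepresentatives

end
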